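import Summits.QuantumFields.YangMills.Theorems.PoincareLipschitzStretchedTail

/-!
# Crux `HistoryTailL` (stmt-QuantumFields-19936), line #12 — THE ψ_α GLUE (S4): THE MOMENT DOOR —
# moment growth of order `q^{1∕α}` IS a ψ_α tail, so `HistoryTailL ⟸ K1-moments(α) ∧ BlockLipschitzL ∧ MeanDeviationL`

Cell `ym3-torus` (YM ladder rung R3 = continuum SU(2) Yang–Mills on the 3-torus — NOT d = 4, NOT infinite volume, NOT a mass gap, NOT the Clay
problem), width seat `ym-ust-19936-w4` gen 13; `--supports stmt-QuantumFields-19936 --as helper`.  Sequel of S1–S3 (✓`local_step_str`,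
✓`localGood_budget_decoupled`, ✓`historyTailL_of_stretchedConcentration`): the weakest typed face of the K1 organ so far.  A CONVERGENT EXPANSION
(cluster ∕ polymer ∕ tree-graph bounds) delivers MOMENTS, not functional inequalities: `‖f − ∫f‖_{L^q(Gibbs_K)} ≤ CM·(n·Λ∕√β_K)·q^{1∕α}` for all
integer `q ≥ 1` (`q!`-type growth is `α = 1`, `(q!)²`-type is `α = ½`, …).  By Markov's inequality at the optimal integer moment this IS a ψ_α tail
`e·exp(−((√β_K·r∕(n·Λ))∕(e·CM))^α)` — so line #12 closes the crux from MOMENT GROWTH OF ANY FINITE ORDER `1∕α` at the Hodge–Poincaré scale.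

* ★`measureReal_ge_le_exp_of_moments` — generic probability: `∫|X|^q ≤ (A·q^{1∕α})^q` for all integers `q ≥ 1` (bounded measurable `X`,
  probability measure) ⟹ `μ{r ≤ X} ≤ e·exp(−(r∕(e·A))^α)` for every `r ≥ 0` (Markov ✓`mul_meas_ge_le_integral_of_nonneg` at `q = ⌊(r∕(eA))^α⌋₊`;
  below the first moment the bound is `≥ 1` for free).
* ★★`strTail_of_momentGrowth` — the K1 binders: moment growth ⟹ K1-ψ_α with `Cc = e`, `cc = ((e·CM)⁻¹)^α` (constants depending on `L` only;
  the boundedness of `f` needed for the moments' integrability is automatic: `Λ`-Lipschitz in the ℓ² link metric, `dist1 ≤ 2` on finitely many bonds).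
* ★★★`historyTailL_of_momentGrowth (α) (hα) (hMom) (hLip : BlockLipschitzL) (hM : MeanDeviationL) : UnitScaleTilt.HistoryTailL` BY NAME (∘ S3).

HONEST: route glue (a door).  The moment bound `hMom` is OPEN — it is a face of the K1 organ (uniform in the cut-off `K`, the torus and `n ≤ β_K`);
nothing of K1∕K2, `MeanDeviationL`, the cruxes, rung R3 or the mass gap is proved.  THEOREMS ONLY, definition-free.
[cite: Balaban1985UV3, (7) p.257 and (71) p.273]
-/

set_option autoImplicit false

noncomputable section

namespace Summit.QuantumFields.YangMills.Theorems.PoincareLipschitzStretched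

open MeasureTheory
open scoped BigOperators
open Literature.MathematicalPhysics.QuantumFieldTheory.Balaban1983to89
open Literature.MathematicalPhysics.QuantumFieldTheory.Balaban1983to89.T3ContinuumYM3Torus
open Literature.MathematicalPhysics.QuantumFieldTheory.Balaban1983to89.T3UnitScaleTilt
open Literature.MathematicalPhysics.QuantumFieldTheory.Balaban1983to89.T3UnitLawDensityEML (ℰp measurableE_ℰp)
open Literature.MathematicalPhysics.QuantumFieldTheory.Balaban1983to89.T4PairDerivBridge (dist1_le_two_specialUnitaryGroup)

/-! ## §1 Generic probability: a ψ_α tail from moment growth of order `q^{1∕α}` -/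

/-- ★ **MOMENT GROWTH OF ORDER `q^{1∕α}` IS A ψ_α TAIL.**  Let `μ` be a probability measure and `X` a bounded measurable real function with
`∫|X|^q dμ ≤ (A·q^{1∕α})^q` for every integer `q ≥ 1` (`A, α > 0`).  Then for every `r ≥ 0`: `μ{r ≤ X} ≤ e·exp(−(r∕(e·A))^α)`.
Proof: with `t := r∕(eA)`, if `t^α < 1` the right-hand side is `≥ e·e^{−1} = 1`; otherwise `q := ⌊t^α⌋₊ ≥ 1`, Markov gives
`μ{r ≤ X} ≤ (A·q^{1∕α}∕r)^q ≤ e^{−q}` (`q^{1∕α} ≤ t`, i.e. `A·q^{1∕α}∕r ≤ e^{−1}`) and `e^{−q} ≤ e·e^{−t^α}` (`t^α < q + 1`). [folklore] -/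
theorem measureReal_ge_le_exp_of_moments {Ω : Type*} [MeasurableSpace Ω] (μ : Measure Ω) [IsProbabilityMeasure μ]
    {X : Ω → ℝ} (hX : Measurable X) (hbdd : ∃ B : ℝ, ∀ ω, |X ω| ≤ B) {A α : ℝ} (hA : 0 < A) (hα : 0 < α)
    (hmom : ∀ q : ℕ, 1 ≤ q → ∫ ω, |X ω| ^ q ∂μ ≤ (A * (q : ℝ) ^ (1 / α)) ^ q) {r : ℝ} (hr : 0 ≤ r) :
    μ.real {ω | r ≤ X ω} ≤ Real.exp 1 * Real.exp (-((r / (Real.exp 1 * A)) ^ α)) := by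
  obtain ⟨B, hB⟩ := hbdd
  have he : 0 < Real.exp 1 := Real.exp_pos 1
  set t : ℝ := r / (Real.exp 1 * A) with ht
  have ht0 : 0 ≤ t := by positivity
  by_cases hcase : t ^ α < 1
  · -- below the first moment: the bound is at least `1`
    calc μ.real {ω | r ≤ X ω} ≤ 1 := measureReal_le_one
      _ = Real.exp 1 * Real.exp (-1) := by rw [← Real.exp_add]; norm_num
      _ ≤ Real.exp 1 * Real.exp (-(t ^ α)) :=
          mul_le_mul_of_nonneg_left (Real.exp_le_exp.mpr (by linarith)) he.le
  rw [not_lt] at hcase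
  -- `r > 0` (else `t = 0` and `t^α = 0 < 1`)
  have hr0 : 0 < r := by
    rcases hr.lt_or_eq with h | h
    · exact h
    · exfalso
      have : t = 0 := by rw [ht, ← h, zero_div]
      rw [this, Real.zero_rpow hα.ne'] at hcase
      linarith
  -- the optimal integer moment
  set q : ℕ := ⌊t ^ α⌋₊ with hq
  have hq1 : 1 ≤ q := by
    rw [hq]
    exact Nat.le_floor_iff (by positivity) |>.mpr (by exact_mod_cast hcase)
  have hqt : (q : ℝ) ≤ t ^ α := Nat.floor_le (by positivity)
  have htq : t ^ α < (q : ℝ) + 1 := Nat.lt_floor_add_one _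
  -- Markov at the `q`-th absolute moment
  have hYm : Measurable fun ω => |X ω| ^ q := (continuous_abs.measurable.comp hX).pow_const q
  have hYint : Integrable (fun ω => |X ω| ^ q) μ :=
    Integrable.mono' (integrable_const (|B| ^ q)) hYm.aestronglyMeasurable
      (ae_of_all _ fun ω => by
        rw [Real.norm_eq_abs, abs_of_nonneg (by positivity)]
        exact pow_le_pow_left₀ (abs_nonneg _) ((hB ω).trans (le_abs_self B)) q)
  have hMarkov := mul_meas_ge_le_integral_of_nonneg (μ := μ) (f := fun ω => |X ω| ^ q)
    (ae_of_all _ fun ω => by positivity) hYint (r ^ q)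
  have hsub : {ω | r ≤ X ω} ⊆ {ω | r ^ q ≤ |X ω| ^ q} := by
    intro ω hω
    simp only [Set.mem_setOf_eq] at hω ⊢
    exact pow_le_pow_left₀ hr (hω.trans (le_abs_self _)) q
  have hrq : 0 < r ^ q := pow_pos hr0 q
  have h1 : μ.real {ω | r ≤ X ω} ≤ (A * (q : ℝ) ^ (1 / α) / r) ^ q := by
    calc μ.real {ω | r ≤ X ω} ≤ μ.real {ω | r ^ q ≤ |X ω| ^ q} := measureReal_mono hsub (measure_ne_top _ _)
      _ ≤ (∫ ω, |X ω| ^ q ∂μ) / r ^ q := by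
          rw [le_div_iff₀ hrq, mul_comm]; exact hMarkov
      _ ≤ (A * (q : ℝ) ^ (1 / α)) ^ q / r ^ q := div_le_div_of_nonneg_right (hmom q hq1) hrq.le
      _ = (A * (q : ℝ) ^ (1 / α) / r) ^ q := by rw [div_pow]
  -- `A·q^{1∕α}∕r ≤ e^{−1}` from `q ≤ t^α`
  have h2 : A * (q : ℝ) ^ (1 / α) / r ≤ Real.exp (-1) := by
    have hqα : (q : ℝ) ^ (1 / α) ≤ t := by
      have h := Real.rpow_le_rpow (Nat.cast_nonneg q) hqt (by positivity : (0 : ℝ) ≤ 1 / α)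
      rwa [one_div, Real.rpow_rpow_inv ht0 hα.ne', ← one_div] at h
    rw [div_le_iff₀ hr0]
    calc A * (q : ℝ) ^ (1 / α) ≤ A * t := mul_le_mul_of_nonneg_left hqα hA.le
      _ = Real.exp (-1) * r := by rw [ht, Real.exp_neg]; field_simp
  have h3 : (A * (q : ℝ) ^ (1 / α) / r) ^ q ≤ Real.exp (-(q : ℝ)) := by
    calc (A * (q : ℝ) ^ (1 / α) / r) ^ q ≤ Real.exp (-1) ^ q := pow_le_pow_left₀ (by positivity) h2 q
      _ = Real.exp (-(q : ℝ)) := by rw [← Real.exp_nat_mul]; ring_nf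
  -- `e^{−q} ≤ e·e^{−t^α}` from `t^α < q + 1`
  have h4 : Real.exp (-(q : ℝ)) ≤ Real.exp 1 * Real.exp (-(t ^ α)) := by
    rw [← Real.exp_add]
    exact Real.exp_le_exp.mpr (by linarith)
  exact h1.trans (h3.trans h4)

/-! ## §2 The K1 binders: moment growth ⟹ K1-ψ_α ⟹ `HistoryTailL` -/

/-- a `Λ`-Lipschitz function in the ℓ² link pseudometric on the (finitely many) bonds is bounded: `|f U| ≤ |f 1| + Λ·√(4·#bonds)`
(`dist1 ≤ 2` on `SU(2)`). [folklore] -/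
theorem abs_le_of_linkLipschitz {P : Params} (f : GaugeField P 0 (Matrix.specialUnitaryGroup (Fin 2) ℂ) → ℝ) {Λ : ℝ} (hΛ : 0 ≤ Λ)
    (hLip : ∀ U U' : GaugeField P 0 (Matrix.specialUnitaryGroup (Fin 2) ℂ),
      |f U - f U'| ≤ Λ * Real.sqrt (∑ b : PBond P 0, GaugeGroup.dist1 (U b * (U' b)⁻¹) ^ 2))
    (U : GaugeField P 0 (Matrix.specialUnitaryGroup (Fin 2) ℂ)) :
    |f U| ≤ |f (fun _ => 1)| + Λ * Real.sqrt (4 * (Fintype.card (PBond P 0) : ℝ)) := by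
  have h := hLip U (fun _ => 1)
  have hsum : ∑ b : PBond P 0, GaugeGroup.dist1 (U b * ((fun _ => (1 : Matrix.specialUnitaryGroup (Fin 2) ℂ)) b)⁻¹) ^ 2 ≤
      4 * (Fintype.card (PBond P 0) : ℝ) := by
    calc ∑ b : PBond P 0, GaugeGroup.dist1 (U b * ((fun _ => (1 : Matrix.specialUnitaryGroup (Fin 2) ℂ)) b)⁻¹) ^ 2
        ≤ ∑ _b : PBond P 0, (4 : ℝ) := Finset.sum_le_sum fun b _ => by
          have h2 := dist1_le_two_specialUnitaryGroup (U b * ((fun _ => (1 : Matrix.specialUnitaryGroup (Fin 2) ℂ)) b)⁻¹)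
          have h0 := GaugeGroup.dist1_nonneg (U b * ((fun _ => (1 : Matrix.specialUnitaryGroup (Fin 2) ℂ)) b)⁻¹)
          nlinarith
      _ = 4 * (Fintype.card (PBond P 0) : ℝ) := by rw [Finset.sum_const, Finset.card_univ, nsmul_eq_mul, mul_comm]
  have hsq : Real.sqrt (∑ b : PBond P 0, GaugeGroup.dist1 (U b * ((fun _ => (1 : Matrix.specialUnitaryGroup (Fin 2) ℂ)) b)⁻¹) ^ 2) ≤
      Real.sqrt (4 * (Fintype.card (PBond P 0) : ℝ)) := Real.sqrt_le_sqrt hsum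
  have hfin : |f U - f (fun _ => 1)| ≤ Λ * Real.sqrt (4 * (Fintype.card (PBond P 0) : ℝ)) :=
    h.trans (mul_le_mul_of_nonneg_left hsq hΛ)
  have := abs_sub_abs_le_abs_sub (f U) (f (fun _ => 1))
  linarith

/-- ★★ **MOMENT GROWTH ⟹ K1-ψ_α** (the K1 binders of line #12): if for every block size `L` there are `CM > 0` and `γ₁ ∈ (0,1]` such that, for
every family `F` with `F.L = L`, every `0 < γ ≤ γ₁`, all cut-offs `K`, box sides `1 ≤ n ≤ β_K` with `2n ≤ #sites`, corners `x₀`, and every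
measurable gauge-invariant box-local `Λ`-Lipschitz `f`, ALL INTEGER CENTRED ABSOLUTE MOMENTS grow at most like `q^{1∕α}` at the Hodge–Poincaré scale —
`∫|f − ∫f|^q d Gibbs_K ≤ (CM·(n·Λ∕√β_K)·q^{1∕α})^q` for `q ≥ 1` — then the ψ_α concentration hypothesis of ✓`historyTailL_of_stretchedConcentration`
holds with `Cc = e` and `cc = ((e·CM)⁻¹)^α`. [folklore; cite: Balaban1985UV3, (7) p.257] -/
theorem strTail_of_momentGrowth {α : ℝ} (hα : 0 < α)
    (hMom : ∀ (L : ℕ), ∃ (CM : ℝ), 0 < CM ∧ ∃ γ₁ : ℝ, 0 < γ₁ ∧ γ₁ ≤ 1 ∧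
      ∀ (F : T3Family) (γ : ℝ), F.L = L → 0 < γ → γ ≤ γ₁ → ∀ (K n : ℕ), 1 ≤ n →
        (n : ℝ) ≤ (F.scheme ℰp γ).β K → 2 * n ≤ (F.P K).sitesPerDir 0 →
        ∀ (x₀ : Site (F.P K) 0) (f : GaugeField (F.P K) 0 (Matrix.specialUnitaryGroup (Fin 2) ℂ) → ℝ) (Λ : ℝ), 0 < Λ →
          Measurable f → GaugeField.GaugeInvariant f →
          (∀ U U' : GaugeField (F.P K) 0 (Matrix.specialUnitaryGroup (Fin 2) ℂ),
            (∀ b : PBond (F.P K) 0, (∀ k, (b.src k - x₀ k).val < n) → (∀ k, (b.tgt k - x₀ k).val < n) → U b = U' b) →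
              f U = f U') →
          (∀ U U' : GaugeField (F.P K) 0 (Matrix.specialUnitaryGroup (Fin 2) ℂ),
            |f U - f U'| ≤ Λ * Real.sqrt (∑ b : PBond (F.P K) 0, GaugeGroup.dist1 (U b * (U' b)⁻¹) ^ 2)) →
          ∀ q : ℕ, 1 ≤ q →
            ∫ U, |f U - ∫ V, f V ∂(gibbsK F ℰp γ K)| ^ q ∂(gibbsK F ℰp γ K) ≤
              (CM * ((n : ℝ) * Λ / Real.sqrt ((F.scheme ℰp γ).β K)) * (q : ℝ) ^ (1 / α)) ^ q) :
    ∀ (L : ℕ), ∃ (Cc cc : ℝ), 0 ≤ Cc ∧ 0 < cc ∧ ∃ γ₁ : ℝ, 0 < γ₁ ∧ γ₁ ≤ 1 ∧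
      ∀ (F : T3Family) (γ : ℝ), F.L = L → 0 < γ → γ ≤ γ₁ → ∀ (K n : ℕ), 1 ≤ n →
        (n : ℝ) ≤ (F.scheme ℰp γ).β K → 2 * n ≤ (F.P K).sitesPerDir 0 →
        ∀ (x₀ : Site (F.P K) 0) (f : GaugeField (F.P K) 0 (Matrix.specialUnitaryGroup (Fin 2) ℂ) → ℝ) (Λ : ℝ), 0 < Λ →
          Measurable f → GaugeField.GaugeInvariant f →
          (∀ U U' : GaugeField (F.P K) 0 (Matrix.specialUnitaryGroup (Fin 2) ℂ),
            (∀ b : PBond (F.P K) 0, (∀ k, (b.src k - x₀ k).val < n) → (∀ k, (b.tgt k - x₀ k).val < n) → U b = U' b) →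
              f U = f U') →
          (∀ U U' : GaugeField (F.P K) 0 (Matrix.specialUnitaryGroup (Fin 2) ℂ),
            |f U - f U'| ≤ Λ * Real.sqrt (∑ b : PBond (F.P K) 0, GaugeGroup.dist1 (U b * (U' b)⁻¹) ^ 2)) →
          ∀ r : ℝ, 0 ≤ r →
            (gibbsK F ℰp γ K).real {U | r ≤ f U - ∫ V, f V ∂(gibbsK F ℰp γ K)} ≤
              Cc * Real.exp (-(cc * (Real.sqrt ((F.scheme ℰp γ).β K) * r / ((n : ℝ) * Λ)) ^ α)) := by
  intro L
  obtain ⟨CM, hCM, γ₁, hγ₁, hγ₁1, H⟩ := hMom L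
  have he : 0 < Real.exp 1 := Real.exp_pos 1
  refine ⟨Real.exp 1, ((Real.exp 1 * CM)⁻¹) ^ α, he.le, Real.rpow_pos_of_pos (by positivity) α, γ₁, hγ₁, hγ₁1, ?_⟩
  intro F γ hFL hγ hγle K n hn hnβ h2n x₀ f Λ hΛ hfm hinv hloc hLip r hr
  haveI := isProbabilityMeasure_gibbsK F ℰp hγ.le K
  set μ := gibbsK F ℰp γ K with hμ
  -- positivity of the Hodge–Poincaré scale
  have hn0 : (0 : ℝ) < (n : ℝ) := by exact_mod_cast (Nat.lt_of_lt_of_le Nat.zero_lt_one hn)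
  have hβpos : 0 < (F.scheme ℰp γ).β K := by
    have hL0 : (0 : ℝ) < (F.L : ℝ) := by exact_mod_cast (lt_of_lt_of_le (by norm_num) F.hL.2.le)
    have heps : (F.P K).eps = ((F.L : ℝ)⁻¹) ^ K := rfl
    show 0 < (γ * (F.P K).eps)⁻¹
    rw [heps]
    positivity
  have hsβ : 0 < Real.sqrt ((F.scheme ℰp γ).β K) := Real.sqrt_pos.mpr hβpos
  set A : ℝ := CM * ((n : ℝ) * Λ / Real.sqrt ((F.scheme ℰp γ).β K)) with hA
  have hA0 : 0 < A := by positivity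
  -- the centred observable is bounded and measurable
  set X : GaugeField (F.P K) 0 (Matrix.specialUnitaryGroup (Fin 2) ℂ) → ℝ := fun U => f U - ∫ V, f V ∂μ with hX
  have hXm : Measurable X := hfm.sub measurable_const
  obtain ⟨B, hB⟩ : ∃ B : ℝ, ∀ U, |f U| ≤ B :=
    ⟨|f (fun _ => 1)| + Λ * Real.sqrt (4 * (Fintype.card (PBond (F.P K) 0) : ℝ)),
      fun U => abs_le_of_linkLipschitz f hΛ.le hLip U⟩
  have hbdd : ∃ B' : ℝ, ∀ U, |X U| ≤ B' := by
    refine ⟨B + |∫ V, f V ∂μ|, fun U => ?_⟩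
    calc |X U| = |f U - ∫ V, f V ∂μ| := rfl
      _ ≤ |f U| + |∫ V, f V ∂μ| := abs_sub _ _
      _ ≤ B + |∫ V, f V ∂μ| := by linarith [hB U]
  -- the generic lemma
  have hgen := measureReal_ge_le_exp_of_moments μ hXm hbdd hA0 hα
    (fun q hq => by simpa only [hX, hA] using H F γ hFL hγ hγle K n hn hnβ h2n x₀ f Λ hΛ hfm hinv hloc hLip q hq) hr
  -- rewrite the exponent: `(r∕(e·A))^α = ((e·CM)⁻¹)^α · (√β_K·r∕(n·Λ))^α`
  have hexp : (r / (Real.exp 1 * A)) ^ α =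
      ((Real.exp 1 * CM)⁻¹) ^ α * (Real.sqrt ((F.scheme ℰp γ).β K) * r / ((n : ℝ) * Λ)) ^ α := by
    have hid : r / (Real.exp 1 * A) = (Real.exp 1 * CM)⁻¹ * (Real.sqrt ((F.scheme ℰp γ).β K) * r / ((n : ℝ) * Λ)) := by
      rw [hA]
      field_simp
    rw [hid, Real.mul_rpow (by positivity) (by positivity)]
  simpa only [hexp] using hgen

/-- ★★★ **`UnitScaleTilt.HistoryTailL ⟸ K1-moments(α) ∧ BlockLipschitzL ∧ MeanDeviationL`, FOR EVERY `α > 0`** (BY NAME): line #12 closes the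
crux stmt-QuantumFields-19936 from centred-moment growth `‖f − ∫f‖_{L^q(Gibbs_K)} ≤ CM·(n·Λ∕√β_K)·q^{1∕α}` (integer `q ≥ 1`) of box-local
gauge-invariant Lipschitz observables at the Hodge–Poincaré scale — no functional inequality (LSI ∕ Poincaré ∕ weak Poincaré) is asked — together
with the route's K2 (`BlockLipschitzL`) and the shared first-moment crux (`MeanDeviationL`).  Composition: `strTail_of_momentGrowth` ∘
✓`historyTailL_of_stretchedConcentration`.  Route glue only: the moment bound, K2 and `MeanDeviationL` are NOT proved.
[cite: Balaban1985UV3, (7) p.257 and (71) p.273] -/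
theorem historyTailL_of_momentGrowth (α : ℝ) (hα : 0 < α)
    (hMom : ∀ (L : ℕ), ∃ (CM : ℝ), 0 < CM ∧ ∃ γ₁ : ℝ, 0 < γ₁ ∧ γ₁ ≤ 1 ∧
      ∀ (F : T3Family) (γ : ℝ), F.L = L → 0 < γ → γ ≤ γ₁ → ∀ (K n : ℕ), 1 ≤ n →
        (n : ℝ) ≤ (F.scheme ℰp γ).β K → 2 * n ≤ (F.P K).sitesPerDir 0 →
        ∀ (x₀ : Site (F.P K) 0) (f : GaugeField (F.P K) 0 (Matrix.specialUnitaryGroup (Fin 2) ℂ) → ℝ) (Λ : ℝ), 0 < Λ →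
          Measurable f → GaugeField.GaugeInvariant f →
          (∀ U U' : GaugeField (F.P K) 0 (Matrix.specialUnitaryGroup (Fin 2) ℂ),
            (∀ b : PBond (F.P K) 0, (∀ k, (b.src k - x₀ k).val < n) → (∀ k, (b.tgt k - x₀ k).val < n) → U b = U' b) →
              f U = f U') →
          (∀ U U' : GaugeField (F.P K) 0 (Matrix.specialUnitaryGroup (Fin 2) ℂ),
            |f U - f U'| ≤ Λ * Real.sqrt (∑ b : PBond (F.P K) 0, GaugeGroup.dist1 (U b * (U' b)⁻¹) ^ 2)) →
          ∀ q : ℕ, 1 ≤ q →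
            ∫ U, |f U - ∫ V, f V ∂(gibbsK F ℰp γ K)| ^ q ∂(gibbsK F ℰp γ K) ≤
              (CM * ((n : ℝ) * Λ / Real.sqrt ((F.scheme ℰp γ).β K)) * (q : ℝ) ^ (1 / α)) ^ q)
    (hLip : Summit.QuantumFields.YangMills.Theses.PoincareLipschitz.BlockLipschitzL)
    (hM : Summit.QuantumFields.YangMills.Theses.PoincareLipschitz.MeanDeviationL) :
    Summit.QuantumFields.YangMills.Theses.UnitScaleTilt.HistoryTailL :=
  historyTailL_of_stretchedConcentration α hα (strTail_of_momentGrowth hα hMom) hLip hM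

end Summit.QuantumFields.YangMills.Theorems.PoincareLipschitzStretched

end
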